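import Summits.QuantumAdvantage.AdviceFreeQNC0.AffBells26CubeIdentity
import HarnessLib

/-!
# AffBells34 — face additivity of loser counts and the DESCENT lemma (planner qa-qnc0-p1 g34, memo ROUND-33 D.16, ask P-37l)

AUTHORED AND PROVED BY THE PLANNER SEAT qa-qnc0-p1 g34 (`HOME/qa-qnc0-p1/exp34/Descent34.lean`, farm rc 0 / 0 sorry); landed VERBATIM
(two one-line docstrings added) by qn-prover-3 g19 (port ask of ROUND-33 §E′ / ROUND-34 §9; route DWalkThree, crux stmt-QuantumAdvantage-22907).

For an admissible cube `(x, A)` the parity of `survSum β c x A` is the parity of the number of LOSING corners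
`x_S`, `S ⊆ A` (`survSum_mod_two_eq_losers`; = Q0 + Q1' + Q1 of `AffBells26`).  Grouping the corners into the
2-faces through two prescribed sites `a₁, a₂` gives the **descent**: an odd cube has an odd admissible 2-sub-cube
`(x_T, {a₁, a₂})`, `T ⊆ A ∖ {a₁, a₂}` (`cubeDescent`, literally the statement `AffBells34.CubeDescent` of
`OddCube34.lean` §8).  Use: abundance of odd `k`-cubes (`k ≈ C log N`, e.g. lone-survivor cubes) ⇒ abundance of
odd 2-cubes with multiplicity `C(N, k-2)·2^{k-2}`.

WHAT THIS IS NOT: no abundance statement is proved here.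
-/

namespace Summit.QuantumAdvantage.AdviceFreeQNC0

namespace AffBells34

open Finset Classical Literature.Computability.QuantumComplexity Literature.Computability.QuantumComplexity.RingHLF
open AffBells23 AffBells26 Fib19

variable {N : ℕ}

/-- Loser indicator of the corner `x_S`. -/
noncomputable def loseInd (β : Fin N → Fin N → ZMod 3) (c : Fin N → ZMod 3) (x : Fin N → Bool) (S : Finset (Fin N)) : ℕ :=
  if RingHLF.Rel (xS x S) (affBell β c (xS x S)) then 0 else 1

/-- the loser indicator only depends on the corner `xS x S`. -/
theorem loseInd_congr (β : Fin N → Fin N → ZMod 3) (c : Fin N → ZMod 3) {x y : Fin N → Bool} {S U : Finset (Fin N)}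
    (h : xS x S = xS y U) : loseInd β c x S = loseInd β c y U := by
  unfold loseInd
  rw [h]

/-- **Loser parity = survivor parity** on an admissible cube with at least two sites. -/
theorem survSum_mod_two_eq_losers (hN : 5 ≤ N) (β : Fin N → Fin N → ZMod 3) (c : Fin N → ZMod 3)
    (x : Fin N → Bool) (A : Finset (Fin N)) (hodd : IsOdd x) (hA : Admissible x A) (hcard : 2 ≤ A.card) :
    survSum β c x A % 2 = (∑ S ∈ A.powerset, loseInd β c x S) % 2 := by
  have hterm : ∀ S ∈ A.powerset, loseInd β c x S % 2 =
      (activeOnes (xS x S) (affBell β c (xS x S)) +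
        (N + zeros (kline (xS x S)) + pairs2 (kline (xS x S)))) % 2 := by
    intro S hS
    have hoddS := (kline_xS hN x hodd hA S (mem_powerset.1 hS)).1
    have hiff := targetFormula N (by omega) (xS x S) hoddS (affBell β c (xS x S))
    unfold loseInd
    by_cases hrel : RingHLF.Rel (xS x S) (affBell β c (xS x S))
    · rw [if_pos hrel]
      have := hiff.1 hrel
      omega
    · rw [if_neg hrel]
      have : ¬ ((activeOnes (xS x S) (affBell β c (xS x S)) + N + zeros (kline (xS x S)) +
          pairs2 (kline (xS x S))) % 2 = 0) := fun h => hrel (hiff.2 h)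
      omega
  symm
  rw [Finset.sum_nat_mod, sum_congr rfl hterm, ← Finset.sum_nat_mod, sum_add_distrib, Nat.add_mod,
    cubeTarget N hN x A hodd hA hcard, add_zero, Nat.mod_mod, cubeIdentity N hN β c x A hodd hA hcard]

/-- Admissibility of the two prescribed sites at every corner `x_T`, `T ⊆ A ∖ {a₁, a₂}`. -/
theorem admissible_xS_pair (hN : 5 ≤ N) {x : Fin N → Bool} {A : Finset (Fin N)} (hodd : IsOdd x) (hA : Admissible x A)
    {a₁ a₂ : Fin N} (ha₁ : a₁ ∈ A) (ha₂ : a₂ ∈ A) {T : Finset (Fin N)} (hT : T ⊆ A \ {a₁, a₂}) :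
    Admissible (xS x T) {a₁, a₂} := by
  have hTA : T ⊆ A := fun i hi => (mem_sdiff.1 (hT hi)).1
  obtain ⟨-, hk⟩ := kline_xS hN x hodd hA T hTA
  constructor
  · intro a ha
    rw [mem_insert, mem_singleton] at ha
    have haA : a ∈ A := by rcases ha with rfl | rfl <;> assumption
    have haT : a ∉ T := by
      intro h
      have := (mem_sdiff.1 (hT h)).2
      rw [mem_insert, mem_singleton] at this
      exact this ha
    obtain ⟨hp, hn⟩ := not_mem_of_admissible hA haA hTA haT
    obtain ⟨k1, k2, k3⟩ := hA.1 a haA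
    refine ⟨?_, ?_, ?_⟩ <;> simp [hk, flipAt, hp, hn, haT, k1, k2, k3]
  · intro a ha a' ha' hne
    rw [mem_insert, mem_singleton] at ha ha'
    have haA : a ∈ A := by rcases ha with rfl | rfl <;> assumption
    have haA' : a' ∈ A := by rcases ha' with rfl | rfl <;> assumption
    exact hA.2 a haA a' haA' hne

/-- a sum over the powerset of a singleton. -/
theorem sum_powerset_singleton' (a : Fin N) (g : Finset (Fin N) → ℕ) :
    ∑ U ∈ ({a} : Finset (Fin N)).powerset, g U = g ∅ + g {a} := by
  have h : ({a} : Finset (Fin N)) = insert a ∅ := by ext; simp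
  rw [h, sum_powerset_insert (notMem_empty a), powerset_empty, sum_singleton, sum_singleton]

/-- **DESCENT (P-37l)**: an odd admissible cube has an odd admissible 2-sub-cube through any two prescribed sites. -/
theorem cubeDescent : ∀ N : ℕ, 5 ≤ N → ∀ (β : Fin N → Fin N → ZMod 3) (c : Fin N → ZMod 3) (x : Fin N → Bool)
    (A : Finset (Fin N)) (a₁ a₂ : Fin N),
    IsOdd x → Admissible x A → a₁ ∈ A → a₂ ∈ A → a₁ ≠ a₂ → survSum β c x A % 2 = 1 →
      ∃ T ⊆ A \ {a₁, a₂}, IsOdd (xS x T) ∧ Admissible (xS x T) {a₁, a₂} ∧ survSum β c (xS x T) {a₁, a₂} % 2 = 1 := by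
  intro N hN β c x A a₁ a₂ hodd hA ha₁ ha₂ hne hodd1
  set B : Finset (Fin N) := A \ {a₁, a₂} with hB
  have hA_eq : A = insert a₁ (insert a₂ B) := by
    ext i
    simp only [hB, mem_insert, mem_sdiff, mem_singleton]
    constructor
    · intro h; tauto
    · rintro (rfl | rfl | ⟨h, -⟩)
      exacts [ha₁, ha₂, h]
  have ha₂B : a₂ ∉ B := by simp [hB]
  have ha₁B : a₁ ∉ insert a₂ B := by simp [hB, hne]
  have hcardA : 2 ≤ A.card := by
    calc 2 = ({a₁, a₂} : Finset (Fin N)).card := (card_pair hne).symm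
      _ ≤ A.card := card_le_card (by
          intro i hi
          rw [mem_insert, mem_singleton] at hi
          rcases hi with rfl | rfl <;> assumption)
  -- loser parity of the big cube, grouped into 2-faces
  have hpar := survSum_mod_two_eq_losers hN β c x A hodd hA hcardA
  rw [hodd1, hA_eq, sum_powerset_insert ha₁B, sum_powerset_insert ha₂B,
    sum_powerset_insert ha₂B (fun t => loseInd β c x (insert a₁ t)), ← sum_add_distrib, ← sum_add_distrib,
    ← sum_add_distrib] at hpar
  -- some face is odd
  have hsum' : (∑ T ∈ B.powerset, (loseInd β c x T + loseInd β c x (insert a₂ T) +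
      (loseInd β c x (insert a₁ T) + loseInd β c x (insert a₁ (insert a₂ T)))) % 2) ≠ 0 := by
    intro h
    rw [Finset.sum_nat_mod, h] at hpar
    omega
  obtain ⟨T, hTB, hT0⟩ := exists_ne_zero_of_sum_ne_zero hsum'
  have hT : (loseInd β c x T + loseInd β c x (insert a₂ T) +
      (loseInd β c x (insert a₁ T) + loseInd β c x (insert a₁ (insert a₂ T)))) % 2 = 1 := by omega
  have hTsub : T ⊆ A \ {a₁, a₂} := by rw [← hB]; exact mem_powerset.1 hTB
  have hTA : T ⊆ A := fun i hi => (mem_sdiff.1 (hTsub hi)).1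
  have ha₁T : a₁ ∉ T := fun h => by
    have := (mem_sdiff.1 (hTsub h)).2
    simp at this
  have ha₂T : a₂ ∉ T := fun h => by
    have := (mem_sdiff.1 (hTsub h)).2
    simp at this
  have ha₁T' : a₁ ∉ insert a₂ T := by
    rw [mem_insert, not_or]
    exact ⟨hne, ha₁T⟩
  have hT2A : insert a₂ T ⊆ A := insert_subset ha₂ hTA
  -- the corner y = x_T
  obtain ⟨hoddT, -⟩ := kline_xS hN x hodd hA T hTA
  have hadm : Admissible (xS x T) {a₁, a₂} := admissible_xS_pair hN hodd hA ha₁ ha₂ hTsub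
  refine ⟨T, hTsub, hoddT, hadm, ?_⟩
  -- the four corners of the 2-cube at y are the four corners of the face
  have hP1 : a₁ ∈ ({a₁, a₂} : Finset (Fin N)) := mem_insert_self _ _
  have hP2 : a₂ ∈ ({a₁, a₂} : Finset (Fin N)) := mem_insert_of_mem (mem_singleton_self _)
  have hsing : ({a₂} : Finset (Fin N)) = insert a₂ ∅ := by ext; simp
  have hsub2 : ({a₂} : Finset (Fin N)) ⊆ {a₁, a₂} := fun i hi => mem_insert_of_mem hi
  have ha₁2 : a₁ ∉ ({a₂} : Finset (Fin N)) := by rw [mem_singleton]; exact hne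
  have e0 : xS (xS x T) ∅ = xS x T := by
    unfold xS
    rw [flipSet_empty, flipAt_empty']
  have e2 : xS (xS x T) {a₂} = xS x (insert a₂ T) := by
    rw [hsing, xS_insert hadm hP2 (empty_subset _) (notMem_empty _), e0, xS_insert hA ha₂ hTA ha₂T]
  have e1 : xS (xS x T) (insert a₁ ∅) = xS x (insert a₁ T) := by
    rw [xS_insert hadm hP1 (empty_subset _) (notMem_empty _), e0, xS_insert hA ha₁ hTA ha₁T]
  have e12 : xS (xS x T) (insert a₁ {a₂}) = xS x (insert a₁ (insert a₂ T)) := by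
    rw [xS_insert hadm hP1 hsub2 ha₁2, e2, xS_insert hA ha₁ hT2A ha₁T']
  have hpar2 := survSum_mod_two_eq_losers hN β c (xS x T) {a₁, a₂} hoddT hadm (by rw [card_pair hne])
  rw [sum_powerset_insert ha₁2, sum_powerset_singleton', sum_powerset_singleton', loseInd_congr β c e0,
    loseInd_congr β c e2, loseInd_congr β c e1, loseInd_congr β c e12] at hpar2
  omega

end AffBells34

end Summit.QuantumAdvantage.AdviceFreeQNC0
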